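import Mathlib
import Summits.ValiantsHypothesis.ValiantsHypothesis.Theorems.NewtonUnitEquationsDissociatedFixedK

/-!
# Crux `TwoProducts` (stmt-5906), line `FrameRungTwo`: binomial frame presentations (tools)

First of three files proving the line's OPEN stub `stub_crossCancelCount` (count of cross-cancelling Newton
vertices of `k` products on TWO dissociated frames) in the binomial regime `t ≤ 2, k ≤ 2`
(`…FrameRungTwoBinomial.lean`: `crossCancelCount_le_two`, `C = 5`).  This file: the floor's lexicographic sort
key `lexKey l` (`…DissociatedFixedKTopTupleCount`) is additive with values in the ordered cancellative monoid
`ℝ ×ₗ (ℕ ×ₗ ℕ)`, so word sums compare termwise (`lexKey_sum_lt_sum`); *presentations* `T, lo` of a binomial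
frame (`T j` the key-top letter of `supp (f j)`, `lo j` the other one; `exists_presentation`); word sums and word
coefficients of ONE product on a dissociated frame in terms of the demotion set `{j : a j ≠ T j}`
(`emb_sum_word`, `prod_coeff_word`, from the floor's `coeff_sum_prod_of_dissociated` at `k = 1`); and Step 1 of
the rigidity argument: at a cross-cancelling exponent the two frames have the SAME top word sum (`top_eq`).
Honest scope: tools for a `t`-variant of one stub of a rung strictly below the crux; nothing here bears on
`VP ≠ VNP`. [ours; setting KPTT arXiv:1308.2286 §2]
-/

set_option linter.dupNamespace false

namespace Summit.ValiantsHypothesis.ValiantsHypothesis.Theorems.NewtonFramesTwoProducts.FrameRungTwoBinomial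

open MvPolynomial
open scoped BigOperators Classical
open Summit.ValiantsHypothesis.Theorems.DissociatedFixedK (lexKey lexKey_injective lexTop lexTop_mem lexKey_le_lexTop
  eq_lexTop_of_forall_le stub_topTupleCount count_arith coeff_sum_prod_of_dissociated exists_word_of_mem_support)
open Summit.ValiantsHypothesis.ValiantsHypothesis.Theorems.DissociatedFixedK.Negative (emb emb_injective)

noncomputable section

/-! ## Keys: the floor's lexicographic sort key is additive and order-compatible -/

/-- `emb` is additive. [folklore] -/
theorem emb_add (a b : Fin 2 →₀ ℕ) : emb (a + b) = emb a + emb b := by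
  funext i
  simp [emb, Finsupp.add_apply, Nat.cast_add]

/-- `emb` of a sum of exponents. [folklore] -/
theorem emb_sum {ι : Type*} (s : Finset ι) (a : ι → (Fin 2 →₀ ℕ)) : emb (∑ i ∈ s, a i) = ∑ i ∈ s, emb (a i) := by
  let φ : (Fin 2 →₀ ℕ) →+ (Fin 2 → ℝ) :=
    { toFun := emb, map_zero' := by funext i; simp [emb], map_add' := emb_add }
  exact map_sum φ a s

/-- The key is additive (values in the lexicographic ordered cancellative monoid `ℝ ×ₗ (ℕ ×ₗ ℕ)`). [folklore] -/
theorem lexKey_add (l : (Fin 2 → ℝ) →L[ℝ] ℝ) (a b : Fin 2 →₀ ℕ) :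
    lexKey l (a + b) = lexKey l a + lexKey l b := by
  simp only [lexKey, emb_add, map_add, Finsupp.add_apply]
  rw [← toLex_add, Prod.mk_add_mk, ← toLex_add, Prod.mk_add_mk]

/-- The key of a sum of exponents is the sum of the keys. [folklore] -/
theorem lexKey_sum (l : (Fin 2 → ℝ) →L[ℝ] ℝ) {ι : Type*} (s : Finset ι) (a : ι → (Fin 2 →₀ ℕ)) :
    lexKey l (∑ i ∈ s, a i) = ∑ i ∈ s, lexKey l (a i) := by
  let φ : (Fin 2 →₀ ℕ) →+ Lex (ℝ × Lex (ℕ × ℕ)) :=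
    { toFun := lexKey l
      map_zero' := by
        simp only [lexKey]
        have h0 : emb 0 = 0 := by funext i; simp [emb]
        rw [h0, map_zero]
        rfl
      map_add' := lexKey_add l }
  exact map_sum φ a s

/-- The functional value is the first component of the key: key comparison controls `l`. [folklore] -/
theorem apply_le_of_lexKey_le (l : (Fin 2 → ℝ) →L[ℝ] ℝ) {a b : Fin 2 →₀ ℕ} (h : lexKey l a ≤ lexKey l b) :
    l (emb a) ≤ l (emb b) := by
  simp only [lexKey, Prod.Lex.le_iff] at h
  rcases h with h | ⟨h, _⟩
  · exact h.le
  · exact h.le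

/-- A strict inequality of functional values gives a strict key inequality. [folklore] -/
theorem lexKey_lt_of_apply_lt (l : (Fin 2 → ℝ) →L[ℝ] ℝ) {a b : Fin 2 →₀ ℕ} (h : l (emb a) < l (emb b)) :
    lexKey l a < lexKey l b := by
  simp only [lexKey, Prod.Lex.lt_iff]
  exact Or.inl h

/-- Strict termwise comparison of word sums: keys add in an ordered cancellative monoid. [folklore] -/
theorem lexKey_sum_lt_sum (l : (Fin 2 → ℝ) →L[ℝ] ℝ) {m : ℕ} (a b : Fin m → (Fin 2 →₀ ℕ))
    (hle : ∀ j, lexKey l (a j) ≤ lexKey l (b j)) (hlt : ∃ j, lexKey l (a j) < lexKey l (b j)) :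
    lexKey l (∑ j, a j) < lexKey l (∑ j, b j) := by
  rw [lexKey_sum, lexKey_sum]
  obtain ⟨j, hj⟩ := hlt
  exact Finset.sum_lt_sum (fun i _ => hle i) ⟨j, Finset.mem_univ _, hj⟩

/-- Termwise comparison of word sums. [folklore] -/
theorem lexKey_sum_le_sum (l : (Fin 2 → ℝ) →L[ℝ] ℝ) {m : ℕ} (a b : Fin m → (Fin 2 →₀ ℕ))
    (hle : ∀ j, lexKey l (a j) ≤ lexKey l (b j)) :
    lexKey l (∑ j, a j) ≤ lexKey l (∑ j, b j) := by
  rw [lexKey_sum, lexKey_sum]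
  exact Finset.sum_le_sum fun i _ => hle i

/-! ## Binomial frame presentations

A *presentation* of the frame of a tuple of factors `f` for the functional `l` is a pair of letter tuples
`T, lo` with `T j, lo j ∈ supp (f j)`, `T j` key-maximal in `supp (f j)`, and `supp (f j) ⊆ {T j, lo j}`
(it exists iff every letter set has at most two elements, `exists_presentation`).  Words `a` (`a j ∈ supp (f j)`)
are then determined by their demotion set `{j : a j ≠ T j}`; `Function.update T j (lo j)` is the one-letter
demotion at `j`, and `emb (T j) - emb (lo j)` is the gap of coordinate `j`. -/

section Frame

variable {m : ℕ}

/-- Binomial letter sets admit a presentation by the key-top letters and the other letters. -/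
theorem exists_presentation (l : (Fin 2 → ℝ) →L[ℝ] ℝ) (f : Fin m → MvPolynomial (Fin 2) ℂ)
    (hne : ∀ j, ((f j).support).Nonempty) (h2 : ∀ j, ((f j).support).card ≤ 2) :
    ∃ T lo : Fin m → (Fin 2 →₀ ℕ), (∀ j, T j = lexTop l ((f j).support) (hne j)) ∧
      (∀ j, T j ∈ (f j).support) ∧ (∀ j, lo j ∈ (f j).support) ∧
      (∀ j, ∀ x ∈ (f j).support, lexKey l x ≤ lexKey l (T j)) ∧
      (∀ j, ∀ x ∈ (f j).support, x = T j ∨ x = lo j) := by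
  classical
  have hlo : ∀ j, ∃ y ∈ (f j).support, ∀ x ∈ (f j).support, x = lexTop l ((f j).support) (hne j) ∨ x = y := by
    intro j
    by_cases h : ∃ y ∈ (f j).support, y ≠ lexTop l ((f j).support) (hne j)
    · obtain ⟨y, hy, hyt⟩ := h
      refine ⟨y, hy, fun x hx => ?_⟩
      by_contra hx'
      push Not at hx'
      have hsub : ({lexTop l ((f j).support) (hne j), y, x} : Finset (Fin 2 →₀ ℕ)) ⊆ (f j).support := by
        intro z hz
        simp only [Finset.mem_insert, Finset.mem_singleton] at hz
        rcases hz with rfl | rfl | rfl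
        · exact lexTop_mem _ _ _
        · exact hy
        · exact hx
      have hcard : ({lexTop l ((f j).support) (hne j), y, x} : Finset (Fin 2 →₀ ℕ)).card = 3 := by
        rw [Finset.card_insert_of_notMem, Finset.card_insert_of_notMem, Finset.card_singleton]
        · simpa using fun h => hx'.2 h.symm
        · simp only [Finset.mem_insert, Finset.mem_singleton, not_or]
          exact ⟨fun h => hyt h.symm, fun h => hx'.1 h.symm⟩
      have := Finset.card_le_card hsub
      rw [hcard] at this
      exact absurd (h2 j) (by omega)
    · push Not at h
      exact ⟨lexTop l ((f j).support) (hne j), lexTop_mem _ _ _, fun x hx => Or.inl (h x hx)⟩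
  choose lo hlo hcov using hlo
  exact ⟨fun j => lexTop l ((f j).support) (hne j), lo, fun j => rfl, fun j => lexTop_mem _ _ _, hlo,
    fun j x hx => lexKey_le_lexTop _ _ _ hx, hcov⟩

/-- A low letter different from the top letter is key-below it. -/
theorem lexKey_lo_lt (l : (Fin 2 → ℝ) →L[ℝ] ℝ) (f : Fin m → MvPolynomial (Fin 2) ℂ) (T lo : Fin m → (Fin 2 →₀ ℕ))
    (hlo : ∀ j, lo j ∈ (f j).support)
    (hTmax : ∀ j, ∀ x ∈ (f j).support, lexKey l x ≤ lexKey l (T j)) {j : Fin m} (h : lo j ≠ T j) : lexKey l (lo j) < lexKey l (T j) :=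
  lt_of_le_of_ne (hTmax j _ (hlo j)) (fun e => h (lexKey_injective l e))

/-- A letter that is not the top letter is the low letter. -/
theorem eq_lo_of_ne (f : Fin m → MvPolynomial (Fin 2) ℂ) (T lo : Fin m → (Fin 2 →₀ ℕ))
    (hcov : ∀ j, ∀ x ∈ (f j).support, x = T j ∨ x = lo j) {a : Fin m → (Fin 2 →₀ ℕ)} (ha : ∀ j, a j ∈ (f j).support) {j : Fin m}
    (hj : a j ≠ T j) : a j = lo j :=
  (hcov j (a j) (ha j)).resolve_left hj

/-- Outside its demotion set a word uses the top letters. -/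
theorem eq_T_of_not_mem_filter (T : Fin m → (Fin 2 →₀ ℕ)) {a : Fin m → (Fin 2 →₀ ℕ)} {j : Fin m}
    (hj : j ∉ Finset.univ.filter fun i => a i ≠ T i) : a j = T j := by
  by_contra h
  exact hj (Finset.mem_filter.2 ⟨Finset.mem_univ _, h⟩)

/-- On its demotion set a word does not use the top letter. -/
theorem ne_T_of_mem_filter (T : Fin m → (Fin 2 →₀ ℕ)) {a : Fin m → (Fin 2 →₀ ℕ)} {j : Fin m}
    (hj : j ∈ Finset.univ.filter fun i => a i ≠ T i) : a j ≠ T j :=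
  (Finset.mem_filter.1 hj).2

/-- **Word sums via gaps**: `emb (Σ_j a_j) = emb (Σ_j T_j) − Σ_{j demoted} (emb T_j − emb lo_j)`. -/
theorem emb_sum_word (f : Fin m → MvPolynomial (Fin 2) ℂ) (T lo : Fin m → (Fin 2 →₀ ℕ))
    (hcov : ∀ j, ∀ x ∈ (f j).support, x = T j ∨ x = lo j) {a : Fin m → (Fin 2 →₀ ℕ)} (ha : ∀ j, a j ∈ (f j).support) :
    emb (∑ j, a j) = emb (∑ j, T j) - ∑ j ∈ Finset.univ.filter (fun i => a i ≠ T i), (emb (T j) - emb (lo j)) := by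
  classical
  rw [emb_sum, emb_sum]
  have h : ∀ j, emb (a j) = emb (T j) -
      (if j ∈ Finset.univ.filter (fun i => a i ≠ T i) then emb (T j) - emb (lo j) else 0) := by
    intro j
    by_cases hj : j ∈ Finset.univ.filter (fun i => a i ≠ T i)
    · rw [if_pos hj, eq_lo_of_ne f T lo hcov ha (ne_T_of_mem_filter T hj)]; abel
    · rw [if_neg hj, eq_T_of_not_mem_filter T hj]; simp
  simp_rw [h]
  rw [Finset.sum_sub_distrib, ← Finset.sum_filter, Finset.filter_mem_eq_inter, Finset.univ_inter]

/-- The one-letter demotion word has letters in the frame. -/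
theorem update_mem (f : Fin m → MvPolynomial (Fin 2) ℂ) (T lo : Fin m → (Fin 2 →₀ ℕ))
    (hT : ∀ j, T j ∈ (f j).support) (hlo : ∀ j, lo j ∈ (f j).support) (j i : Fin m) : Function.update T j (lo j) i ∈ (f i).support := by
  rcases eq_or_ne i j with rfl | h
  · rw [Function.update_self]; exact hlo i
  · rw [Function.update_of_ne h]; exact hT i

/-- The demotion set of the one-letter demotion at `j` is `{j}`. -/
theorem filter_update (T lo : Fin m → (Fin 2 →₀ ℕ)) {j : Fin m} (h : lo j ≠ T j) :
    (Finset.univ.filter fun i => Function.update T j (lo j) i ≠ T i) = {j} := by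
  classical
  ext i
  rw [Finset.mem_filter, Finset.mem_singleton]
  rcases eq_or_ne i j with rfl | hne
  · rw [Function.update_self]; exact ⟨fun _ => rfl, fun _ => ⟨Finset.mem_univ _, h⟩⟩
  · rw [Function.update_of_ne hne]; exact ⟨fun h' => absurd rfl h'.2, fun h' => absurd h' hne⟩

/-- A genuine one-letter demotion is not the top tuple. -/
theorem update_ne_T (T lo : Fin m → (Fin 2 →₀ ℕ)) {j : Fin m} (h : lo j ≠ T j) : Function.update T j (lo j) ≠ T := by
  intro h'
  have := congrFun h' j
  rw [Function.update_self] at this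
  exact h this

/-- The sum of the one-letter demotion at `j` is the top sum minus the gap of `j`. -/
theorem emb_sum_update (f : Fin m → MvPolynomial (Fin 2) ℂ) (T lo : Fin m → (Fin 2 →₀ ℕ))
    (hT : ∀ j, T j ∈ (f j).support) (hlo : ∀ j, lo j ∈ (f j).support)
    (hcov : ∀ j, ∀ x ∈ (f j).support, x = T j ∨ x = lo j) {j : Fin m} (h : lo j ≠ T j) :
    emb (∑ i, Function.update T j (lo j) i) = emb (∑ i, T i) - (emb (T j) - emb (lo j)) := by
  rw [emb_sum_word f T lo hcov (update_mem f T lo hT hlo j), filter_update T lo h, Finset.sum_singleton]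

/-- A word other than the top tuple has a key-smaller sum. -/
theorem lexKey_sum_lt_T (l : (Fin 2 → ℝ) →L[ℝ] ℝ) (f : Fin m → MvPolynomial (Fin 2) ℂ) (T : Fin m → (Fin 2 →₀ ℕ))
    (hTmax : ∀ j, ∀ x ∈ (f j).support, lexKey l x ≤ lexKey l (T j)) {a : Fin m → (Fin 2 →₀ ℕ)} (ha : ∀ j, a j ∈ (f j).support)
    (hne : a ≠ T) : lexKey l (∑ j, a j) < lexKey l (∑ j, T j) := by
  apply lexKey_sum_lt_sum l
  · exact fun j => hTmax j _ (ha j)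
  · obtain ⟨j, hj⟩ := Function.ne_iff.1 hne
    exact ⟨j, lt_of_le_of_ne (hTmax j _ (ha j)) (fun e => hj (lexKey_injective l e))⟩

/-- Every word sum is key-below the top sum. -/
theorem lexKey_sum_le_T (l : (Fin 2 → ℝ) →L[ℝ] ℝ) (f : Fin m → MvPolynomial (Fin 2) ℂ) (T : Fin m → (Fin 2 →₀ ℕ))
    (hTmax : ∀ j, ∀ x ∈ (f j).support, lexKey l x ≤ lexKey l (T j)) {a : Fin m → (Fin 2 →₀ ℕ)} (ha : ∀ j, a j ∈ (f j).support) :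
    lexKey l (∑ j, a j) ≤ lexKey l (∑ j, T j) :=
  lexKey_sum_le_sum l _ _ fun j => hTmax j _ (ha j)

/-- A word demoting `j` AND another coordinate has a sum key-below the one-letter demotion at `j`. -/
theorem lexKey_sum_lt_update (l : (Fin 2 → ℝ) →L[ℝ] ℝ) (f : Fin m → MvPolynomial (Fin 2) ℂ) (T lo : Fin m → (Fin 2 →₀ ℕ))
    (hlo : ∀ j, lo j ∈ (f j).support)
    (hTmax : ∀ j, ∀ x ∈ (f j).support, lexKey l x ≤ lexKey l (T j))
    (hcov : ∀ j, ∀ x ∈ (f j).support, x = T j ∨ x = lo j) {a : Fin m → (Fin 2 →₀ ℕ)}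
    (ha : ∀ j, a j ∈ (f j).support) {j j' : Fin m} (hj : a j ≠ T j) (hj' : a j' ≠ T j')
    (hjj' : j' ≠ j) : lexKey l (∑ i, a i) < lexKey l (∑ i, Function.update T j (lo j) i) := by
  apply lexKey_sum_lt_sum l
  · intro i
    rcases eq_or_ne i j with rfl | hne
    · rw [Function.update_self, eq_lo_of_ne f T lo hcov ha hj]
    · rw [Function.update_of_ne hne]; exact hTmax i _ (ha i)
  · refine ⟨j', ?_⟩
    rw [Function.update_of_ne hjj', eq_lo_of_ne f T lo hcov ha hj']
    exact lexKey_lo_lt l f T lo hlo hTmax (fun h => hj' (by rw [eq_lo_of_ne f T lo hcov ha hj', h]))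

end Frame

/-! ## Coefficients of one product on a dissociated frame -/

section Coeff

variable {m : ℕ}

/-- Coefficient of a word sum in (l : (Fin 2 → ℝ) →L[ℝ] ℝ) (f : Fin m → MvPolynomial (Fin 2) ℂ) (T lo : Fin m → (Fin 2 →₀ ℕ))
    (hT : ∀ j, T j ∈ (f j).support) (hlo : ∀ j, lo j ∈ (f j).support)
    (hTmax : ∀ j, ∀ x ∈ (f j).support, lexKey l x ≤ lexKey l (T j))
    (hcov : ∀ j, ∀ x ∈ (f j).support, x = T j ∨ x = lo j) product on a dissociated frame = product of the letter coefficients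
(the floor's `coeff_sum_prod_of_dissociated` at `k = 1`). [folklore] -/
theorem coeff_word (f : Fin m → MvPolynomial (Fin 2) ℂ)
    (hinjf : ∀ a b : Fin m → (Fin 2 →₀ ℕ), (∀ j, a j ∈ (f j).support) → (∀ j, b j ∈ (f j).support) →
      ∑ j, a j = ∑ j, b j → a = b)
    (a : Fin m → (Fin 2 →₀ ℕ)) (ha : ∀ j, a j ∈ (f j).support) :
    coeff (∑ j, a j) (∏ j, f j) = ∏ j, coeff (a j) (f j) := by
  have h := coeff_sum_prod_of_dissociated (fun j => (f j).support) (fun _ : Fin 1 => f)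
    (fun _ j => subset_rfl) hinjf a ha
  simpa using h

/-- Every exponent of (l : (Fin 2 → ℝ) →L[ℝ] ℝ) (f : Fin m → MvPolynomial (Fin 2) ℂ) (T lo : Fin m → (Fin 2 →₀ ℕ))
    (hT : ∀ j, T j ∈ (f j).support) (hlo : ∀ j, lo j ∈ (f j).support)
    (hTmax : ∀ j, ∀ x ∈ (f j).support, lexKey l x ≤ lexKey l (T j))
    (hcov : ∀ j, ∀ x ∈ (f j).support, x = T j ∨ x = lo j) product on a dissociated frame is a word sum. [folklore] -/
theorem exists_word (f : Fin m → MvPolynomial (Fin 2) ℂ)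
    (hinjf : ∀ a b : Fin m → (Fin 2 →₀ ℕ), (∀ j, a j ∈ (f j).support) → (∀ j, b j ∈ (f j).support) →
      ∑ j, a j = ∑ j, b j → a = b)
    {x : Fin 2 →₀ ℕ} (hx : x ∈ (∏ j, f j).support) :
    ∃ a : Fin m → (Fin 2 →₀ ℕ), (∀ j, a j ∈ (f j).support) ∧ ∑ j, a j = x := by
  have hx' : x ∈ (∑ _i : Fin 1, ∏ j, f j).support := by simpa using hx
  obtain ⟨a, ha, hax, -⟩ := exists_word_of_mem_support (fun j => (f j).support) (fun _ : Fin 1 => f)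
    (fun _ j => subset_rfl) hinjf hx'
  exact ⟨a, ha, hax⟩

/-- Letter coefficients of a word are nonzero, so the word coefficient is nonzero. [folklore] -/
theorem prod_coeff_ne_zero (f : Fin m → MvPolynomial (Fin 2) ℂ) (a : Fin m → (Fin 2 →₀ ℕ))
    (ha : ∀ j, a j ∈ (f j).support) : ∏ j, coeff (a j) (f j) ≠ 0 :=
  Finset.prod_ne_zero_iff.2 fun j _ => mem_support_iff.1 (ha j)

/-- **Word coefficient via ratios**: `Π_j c(a_j) = (Π_j c(T_j)) · Π_{j demoted} c(lo_j)/c(T_j)`. -/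
theorem prod_coeff_word (f : Fin m → MvPolynomial (Fin 2) ℂ) (T lo : Fin m → (Fin 2 →₀ ℕ))
    (hT : ∀ j, T j ∈ (f j).support)
    (hcov : ∀ j, ∀ x ∈ (f j).support, x = T j ∨ x = lo j) (a : Fin m → (Fin 2 →₀ ℕ)) (ha : ∀ j, a j ∈ (f j).support) :
    ∏ j, coeff (a j) (f j) = (∏ j, coeff (T j) (f j)) *
      ∏ j ∈ Finset.univ.filter (fun i => a i ≠ T i), (coeff (lo j) (f j) / coeff (T j) (f j)) := by
  classical
  have h : ∀ j, coeff (a j) (f j) = coeff (T j) (f j) *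
      (if j ∈ Finset.univ.filter (fun i => a i ≠ T i) then coeff (lo j) (f j) / coeff (T j) (f j) else 1) := by
    intro j
    by_cases hj : j ∈ Finset.univ.filter (fun i => a i ≠ T i)
    · rw [if_pos hj, eq_lo_of_ne f T lo hcov ha (ne_T_of_mem_filter T hj),
        mul_div_cancel₀ _ (mem_support_iff.1 (hT j))]
    · rw [if_neg hj, eq_T_of_not_mem_filter T hj, mul_one]
  simp_rw [h]
  rw [Finset.prod_mul_distrib, ← Finset.prod_filter, Finset.filter_mem_eq_inter, Finset.univ_inter]

end Coeff

/-! ## Two dissociated binomial frames at a cross-cancelling exponent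

Data for the rest of the file: a functional `l`, two tuples of binomial factors `f, g` on dissociated frames
(their own supports, with presentations `T, lo` and `T', lo'`), and an exponent `e` such that every exponent
`x ≠ e` with `l e ≤ l x` is cancelled in `Π f + Π g` (`hzero`: what a strictly exposing functional at the
vertex `emb e` provides). -/

section TwoFrames

variable {m : ℕ}

/-- **Step 1 (common top).**  If some exponent of `Π f` lies strictly `l`-above `e`, the two top word sums
agree and lie key-above `e`. -/
theorem top_eq (l : (Fin 2 → ℝ) →L[ℝ] ℝ) (f g : Fin m → MvPolynomial (Fin 2) ℂ) (T T' : Fin m → (Fin 2 →₀ ℕ))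
    (hT : ∀ j, T j ∈ (f j).support) (hTmax : ∀ j, ∀ x ∈ (f j).support, lexKey l x ≤ lexKey l (T j))
    (hT' : ∀ j, T' j ∈ (g j).support) (hTmax' : ∀ j, ∀ x ∈ (g j).support, lexKey l x ≤ lexKey l (T' j))
    (hinjf : ∀ a b : Fin m → (Fin 2 →₀ ℕ), (∀ j, a j ∈ (f j).support) → (∀ j, b j ∈ (f j).support) →
      ∑ j, a j = ∑ j, b j → a = b)
    (hinjg : ∀ a b : Fin m → (Fin 2 →₀ ℕ), (∀ j, a j ∈ (g j).support) → (∀ j, b j ∈ (g j).support) →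
      ∑ j, a j = ∑ j, b j → a = b)
    (e : Fin 2 →₀ ℕ)
    (hzero : ∀ x : Fin 2 →₀ ℕ, x ≠ e → l (emb e) ≤ l (emb x) → coeff x (∏ j, f j) + coeff x (∏ j, g j) = 0)
    (hq : ∃ x ∈ (∏ j, f j).support, l (emb e) < l (emb x)) :
    ∑ j, T j = ∑ j, T' j ∧ lexKey l e < lexKey l (∑ j, T j) := by
  obtain ⟨x, hx, hlx⟩ := hq
  obtain ⟨a, ha, rfl⟩ := exists_word f hinjf hx
  have hTA : l (emb e) < l (emb (∑ j, T j)) :=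
    lt_of_lt_of_le hlx (apply_le_of_lexKey_le l (lexKey_sum_le_sum l _ _ fun j => hTmax j _ (ha j)))
  have hcA : coeff (∑ j, T j) (∏ j, f j) ≠ 0 := by
    rw [coeff_word f hinjf _ hT]; exact prod_coeff_ne_zero f _ hT
  have hzA := hzero _ (fun h => by rw [h] at hTA; exact lt_irrefl _ hTA) hTA.le
  have hgA : (∑ j, T j) ∈ (∏ j, g j).support := by
    rw [mem_support_iff]; intro h; rw [h, add_zero] at hzA; exact hcA hzA
  obtain ⟨a', ha', hsum'⟩ := exists_word g hinjg hgA
  have hAB : lexKey l (∑ j, T j) ≤ lexKey l (∑ j, T' j) := by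
    rw [← hsum']; exact lexKey_sum_le_sum l _ _ fun j => hTmax' j _ (ha' j)
  have hTB : l (emb e) < l (emb (∑ j, T' j)) := lt_of_lt_of_le hTA (apply_le_of_lexKey_le l hAB)
  have hcB : coeff (∑ j, T' j) (∏ j, g j) ≠ 0 := by
    rw [coeff_word g hinjg _ hT']; exact prod_coeff_ne_zero g _ hT'
  have hzB := hzero _ (fun h => by rw [h] at hTB; exact lt_irrefl _ hTB) hTB.le
  have hfB : (∑ j, T' j) ∈ (∏ j, f j).support := by
    rw [mem_support_iff]; intro h; rw [h, zero_add] at hzB; exact hcB hzB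
  obtain ⟨a'', ha'', hsum''⟩ := exists_word f hinjf hfB
  have hBA : lexKey l (∑ j, T' j) ≤ lexKey l (∑ j, T j) := by
    rw [← hsum'']; exact lexKey_sum_le_sum l _ _ fun j => hTmax j _ (ha'' j)
  exact ⟨lexKey_injective l (le_antisymm hAB hBA), lexKey_lt_of_apply_lt l hTA⟩

/-- One-letter demotion words of distinct demotable coordinates have distinct sums. -/
theorem update_sum_injective (f : Fin m → MvPolynomial (Fin 2) ℂ) (T lo : Fin m → (Fin 2 →₀ ℕ))
    (hT : ∀ j, T j ∈ (f j).support) (hlo : ∀ j, lo j ∈ (f j).support)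
    (hinjf : ∀ a b : Fin m → (Fin 2 →₀ ℕ), (∀ j, a j ∈ (f j).support) → (∀ j, b j ∈ (f j).support) →
      ∑ j, a j = ∑ j, b j → a = b)
    {i j : Fin m} (hi : lo i ≠ T i)
    (h : ∑ i', Function.update T i (lo i) i' = ∑ i', Function.update T j (lo j) i') : i = j := by
  have hmem : ∀ k i', Function.update T k (lo k) i' ∈ (f i').support := by
    intro k i'
    rcases eq_or_ne i' k with rfl | hne
    · rw [Function.update_self]; exact hlo i'
    · rw [Function.update_of_ne hne]; exact hT i'
  have hw := hinjf _ _ (hmem i) (hmem j) h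
  by_contra hne
  have h' := congrFun hw i
  rw [Function.update_self, Function.update_of_ne hne] at h'
  exact hi h'

end TwoFrames

end

end Summit.ValiantsHypothesis.ValiantsHypothesis.Theorems.NewtonFramesTwoProducts.FrameRungTwoBinomial
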